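import Literature.Analysis.FluidPDE.TorusLpOperatorFacts
import Literature.Analysis.FunctionSpaces.TorusKernelSmoothing
import Literature.Analysis.FunctionSpaces.MinkowskiIntegral
import Literature.Analysis.UnboundedOperators.HeatKernelCancellation
import Literature.Analysis.UnboundedOperators.HeatFlowCalculus
import Mathlib.Analysis.SpecialFunctions.Gamma.Basic
import Mathlib.Analysis.SpecialFunctions.Gaussian.GaussianIntegral
import HarnessLib

/-!
# `‖|∇|⁻¹ u‖_p ≲ κ⁻¹ ‖u‖_p` for fields with spectrum in `{|k| ≥ κ}`: discharge of `Torus.rieszPotential_Lp_bound_of_freqSupport`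

Analysis/FluidPDE proof file, sibling of the facts file `TorusLpOperatorFacts` (T. Luo, E. S. Titi,
Calc. Var. PDE 59 (2020), §3; T. Buckmaster, V. Vicol, Ann. of Math. 189 (2019), §5 and App. B).
It **discharges** two of its named facts (D-0014):

* `Torus.rieszPotential_Lp_bound_of_freqSupport_holds : rieszPotential_Lp_bound_of_freqSupport d`
  — Buckmaster–Vicol, App. B, proof of Lemma B.1: "`‖|∇|⁻¹ P_{≥κ/2}‖_{L^p→L^p} ≲ 1/κ`, which is a
  direct consequence of the Littlewood–Paley decomposition" (exact-Fourier-support rendering of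
  the facts file, header item 1): for `1 < p < ∞` a constant `C` with
  `‖(-Δ)^{-1/2} u‖_{L^p(T^d)} ≤ C κ⁻¹ ‖u‖_{L^p(T^d)}` for all `κ ≥ 1` and all smooth real vector
  fields `u` whose Fourier coefficients vanish on `{|k| < κ}`;
* `Torus.rieszPotential_Lp_bound_holds : rieszPotential_Lp_bound d` — ibid.: "the bound
  `‖|∇|⁻¹ P_{≠0}‖_{L^p→L^p} ≲ 1`", the case `κ = 1` applied to `u - ⨍u`.

Both hold in every dimension `d` (the proof gives them for all `1 ≤ p < ∞`; the facts ask
`1 < p < ∞`). The source prints no proof; ours avoids Littlewood–Paley square functions: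

1. **Subordination** (`fracLaplacian_neg_half_eq_integral_heatSmoothing`):
   `(4π²|k|²)^{-1/2} = π^{-1/2} ∫₀^∞ t^{-1/2} e^{-4π²|k|²t} dt` (`Γ(1/2) = √π`), hence pointwise
   `(-Δ)^{-1/2}u(x) = ∫₀^∞ π^{-1/2} t^{-1/2} (e^{tΔ}u)(x) dt`, where
   `e^{tΔ}u(x) = ∫_{ℝ^d} G_t(z) u(x - proj z) dz` is the heat smoothing of the tree
   (`FunctionSpaces/TorusHeatSmoothing`, with its Fourier series `Torus.hasSum_heatSmoothing`);
   the `t`-integral and the `k`-sum are exchanged by absolute convergence (`integral_tsum`).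
2. **Two bounds for `e^{tΔ}` on `L^p(T^d)`**: the contraction `‖e^{tΔ}u‖_p ≤ ‖u‖_p`
   (`Torus.eLpNorm_heatSmoothing_le`) and, for `spec u ⊂ {|k| ≥ κ}`, the gain
   `‖e^{tΔ}u‖_p ≤ C/(κ²t) ‖u‖_p` (`exists_eLpNorm_heatSmoothing_le_of_freqSupport`): the kernel
   `G_t` may be exchanged for `G_t - Ψ ⋆ G_t` with `𝓕Ψ = 1`-type cancellation at low frequencies
   (`UnboundedOperators.exists_heatKernel_lowFreq_cancellation`: `𝓕(Ψ ⋆ G_t) = 0` on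
   `{‖ξ‖ ≥ κ}` and `‖G_t - Ψ ⋆ G_t‖_{L¹(ℝ^d)} ≤ C/(κ²t)` by the second-order translation modulus
   of the Gaussian), since both kernels have the same lattice Fourier data on the spectrum of `u`
   (`FunctionSpaces.Torus.integral_kernel_smul_eq_of_fourier_eq`), and whole-space `L¹` kernels
   act on `L^p(T^d)` with norm `≤ ‖K‖_{L¹}` (`FunctionSpaces.Torus.eLpNorm_integral_kernel_smul_le`).
3. **Minkowski in `t`** (`FunctionSpaces.eLpNorm_integral_le_lintegral_eLpNorm`) and the
   elementary integral `∫₀^∞ π^{-1/2} t^{-1/2} min(1, C/(κ²t)) dt ≤ π^{-1/2}(2 + 2C) κ⁻¹`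
   (`lintegral_subordinationWeight_mul_min_le`, split at `t = κ⁻²`).

This is the real-variable proof of the Bernstein-type inequality through the heat semigroup
(Stein 1970, Ch. III §2 and Ch. V §3.2: Riesz potentials subordinated to the Gauss–Weierstrass
semigroup); the kernel `π^{-1/2}∫₀^∞ t^{-1/2}(G_t - Ψ ⋆ G_t) dt` is the `L¹` kernel of
`(1 - 𝓕Ψ(ξ))/(2π|ξ|)` announced in the docstring of the fact.

## Mathlib / tree search

Mathlib: `Real.integral_rpow_mul_exp_neg_mul_Ioi`, `Real.Gamma_one_half_eq`,
`integrableOn_rpow_mul_exp_neg_mul_rpow`, `integral_tsum`, `integral_rpow`,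
`eLpNorm_le_eLpNorm_of_exponent_le`; no fractional Laplacian on the torus, no Bernstein
inequality. Tree (all reused): `Torus.fracLaplacian`/`fracSymbol` (`FluidPDE/FractionalNSTorus`),
`Torus.IsFreqSupportedOff`, the two facts (`FluidPDE/TorusLpOperatorFacts`);
`Torus.hasSum_heatSmoothing`, `Torus.continuousOn_heatSmoothing`, `Torus.eLpNorm_heatSmoothing_le`,
`Torus.norm_latticeVec_sq` (`FunctionSpaces/TorusHeatSmoothing`); `FunctionSpaces/TorusKernelSmoothing`;
`UnboundedOperators/HeatKernelCancellation`; `UnboundedOperators.lintegral_Ioi_rpow`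
(`HeatFlowCalculus`); `FunctionSpaces.eLpNorm_integral_le_lintegral_eLpNorm` (`MinkowskiIntegral`);
`Torus.mFourierCoeff_complexify_sub_const_smul`, `Torus.summable_norm_mFourierCoeff_of_isSmooth`
(`TorusFourierSeries`); `Torus.one_le_freqNormSq_of_ne_zero` (`TorusInverseLaplacian`);
`Torus.integral_mFourier` (`TorusTrigPoly`).

## References

* T. Buckmaster, V. Vicol, *Nonuniqueness of weak solutions to the Navier–Stokes equation*,
  Ann. of Math. 189 (2019), 101–144 = arXiv:1709.10033, App. B, Lemma B.1 and its proof
  (held text `paper:arxiv-1709.10033`, page file p0023). [`BuckmasterVicol2019AnnMath`]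
* T. Luo, E. S. Titi, Calc. Var. PDE 59 (2020) = arXiv:1808.07595, §3.5, proof of Lemma 6.
  [`LuoTiti2020`]
* E. M. Stein, *Singular Integrals and Differentiability Properties of Functions*, Princeton
  (1970), Ch. III §2, Ch. V §3.2. [`SteinSingularIntegrals1970`]
* L. Grafakos, *Classical Fourier Analysis*, 3rd ed. (2014), §3.1.1, Thm. 4.3.7, §5.1. [`Grafakos2014`]
-/

noncomputable section

open MeasureTheory Set Filter Function UnitAddTorus Complex
open Literature.Analysis.UnboundedOperators
open scoped ENNReal NNReal FourierTransform RealInnerProductSpace Convolution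

namespace Literature.Analysis.FluidPDE

namespace Torus

open FunctionSpaces FunctionSpaces.Torus

variable {d : Type*} [Fintype d] [DecidableEq d]

/-! ## The subordination integral `π^{-1/2} ∫₀^∞ t^{-1/2} e^{-λt} dt = λ^{-1/2}` -/

omit [Fintype d] [DecidableEq d] in
/-- `∫₀^∞ t^{-1/2} e^{-tλ} dt = √π λ^{-1/2}` for `λ > 0` (Euler's integral `Γ(1/2) = √π`). [folklore] -/
theorem integral_rpow_neg_half_mul_exp_neg {l : ℝ} (hl : 0 < l) :
    ∫ t in Ioi (0 : ℝ), t ^ (-(1 / 2 : ℝ)) * Real.exp (-(t * l)) = Real.sqrt Real.pi * l ^ (-(1 / 2 : ℝ)) := by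
  have h := Real.integral_rpow_mul_exp_neg_mul_Ioi (a := 1 / 2) (r := l) one_half_pos hl
  have e1 : (1 / 2 : ℝ) - 1 = -(1 / 2) := by norm_num
  rw [e1, Real.Gamma_one_half_eq] at h
  simp_rw [mul_comm l] at h
  rw [h, one_div, Real.inv_rpow hl.le, Real.rpow_neg hl.le, mul_comm]

omit [Fintype d] [DecidableEq d] in
/-- Integrability of `t ↦ t^{-1/2} e^{-tλ}` on `(0, ∞)` for `λ > 0`. [folklore] -/
theorem integrableOn_rpow_neg_half_mul_exp_neg {l : ℝ} (hl : 0 < l) :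
    IntegrableOn (fun t : ℝ => t ^ (-(1 / 2 : ℝ)) * Real.exp (-(t * l))) (Ioi 0) := by
  have h := integrableOn_rpow_mul_exp_neg_mul_rpow (s := -(1 / 2)) (p := 1) (b := l)
    (by norm_num) le_rfl hl
  refine h.congr_fun (fun _ _ => ?_) measurableSet_Ioi
  simp only [Real.rpow_one, neg_mul, mul_comm l]

omit [Fintype d] [DecidableEq d] in
/-- `π^{-1/2} √π = 1`. [folklore] -/
theorem pi_rpow_neg_half_mul_sqrt_pi : Real.pi ^ (-(1 / 2 : ℝ)) * Real.sqrt Real.pi = 1 := by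
  rw [Real.sqrt_eq_rpow, ← Real.rpow_add Real.pi_pos]
  norm_num

omit [Fintype d] [DecidableEq d] in
/-- The subordination weight `π^{-1/2} t^{-1/2}` is continuous on `(0, ∞)`. [folklore] -/
theorem continuousOn_subordinationWeight :
    ContinuousOn (fun t : ℝ => Real.pi ^ (-(1 / 2 : ℝ)) * t ^ (-(1 / 2 : ℝ))) (Ioi 0) :=
  continuousOn_const.mul (continuousOn_id.rpow_const fun _ ht => Or.inl (ne_of_gt ht))

/-! ## Heat smoothing of a field with spectrum off a ball: the `L^p` gain `C/(κ²t)` -/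

/-- **Low-frequency cancellation for the heat smoothing on the torus.** There is `C = C(d)` such
that for every `κ ≥ 1`, every smooth real vector field `u` on `T^d` whose Fourier coefficients
vanish on `{|k| < κ}`, every `t > 0` and `1 ≤ p < ∞`,
`‖x ↦ ∫ G_t(z) u(x - proj z) dz‖_{L^p} ≤ C/(κ²t) · ‖u‖_{L^p}`: by
`UnboundedOperators.exists_heatKernel_lowFreq_cancellation` the kernel `G_t` may be replaced by
`G_t - Ψ ⋆ G_t` (same lattice Fourier data on the spectrum of `u`,
`FunctionSpaces.Torus.integral_kernel_smul_eq_of_fourier_eq`), whose `L¹` norm is `≤ C/(κ²t)`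
(`FunctionSpaces.Torus.eLpNorm_integral_kernel_smul_le`). [folklore] -/
theorem exists_eLpNorm_heatSmoothing_le_of_freqSupport :
    ∃ C : ℝ, 0 ≤ C ∧ ∀ κ : ℝ, 1 ≤ κ → ∀ u : UnitAddTorus d → EuclideanSpace ℝ d,
      IsSmooth u → IsFreqSupportedOff κ u → ∀ t : ℝ, 0 < t → ∀ p : ℝ≥0∞, 1 ≤ p → p ≠ ⊤ →
        eLpNorm (fun x => ∫ z : EuclideanSpace ℝ d, heatKernel t z • u (x - proj z)) p volume ≤
          ENNReal.ofReal (C / (κ ^ 2 * t)) * eLpNorm u p volume := by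
  obtain ⟨C, hC0, hC⟩ := exists_heatKernel_lowFreq_cancellation (E := EuclideanSpace ℝ d)
  refine ⟨C, hC0, fun κ hκ u hu hsupp t ht p hp hp' => ?_⟩
  have hκ0 : 0 < κ := one_pos.trans_le hκ
  obtain ⟨Ψ, hΨi, hΨF, hΨL⟩ := hC κ hκ0
  set K : EuclideanSpace ℝ d → ℝ := fun z =>
    heatKernel t z - (Ψ ⋆[ContinuousLinearMap.lsmul ℝ ℝ, volume] heatKernel t) z with hK
  have hGi : Integrable (heatKernel (E := EuclideanSpace ℝ d) t) volume := integrable_heatKernel_holds ht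
  have hCi : Integrable (Ψ ⋆[ContinuousLinearMap.lsmul ℝ ℝ, volume] heatKernel t) volume :=
    hΨi.integrable_convolution _ hGi
  have hKi : Integrable K volume := hGi.sub hCi
  -- the two kernels have the same lattice Fourier data on the spectrum of `u`
  have hswap : ∀ x, ∫ z : EuclideanSpace ℝ d, heatKernel t z • u (x - proj z) =
      ∫ z : EuclideanSpace ℝ d, K z • u (x - proj z) := by
    refine integral_kernel_smul_eq_of_fourier_eq hGi hKi hu fun k hk => ?_
    have hk' : κ ≤ ‖latticeVec k‖ := by
      by_contra hlt
      push Not at hlt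
      refine hk (hsupp k ?_)
      rw [← norm_latticeVec_sq]
      exact (sq_lt_sq' (by linarith [norm_nonneg (latticeVec k)]) hlt)
    rw [← integral_ofReal_mul_mFourier_neg_proj, ← integral_ofReal_mul_mFourier_neg_proj]
    have hsub : ∀ z, (K z : ℂ) * mFourier k (-proj z) = (heatKernel t z : ℂ) * mFourier k (-proj z) -
        ((Ψ ⋆[ContinuousLinearMap.lsmul ℝ ℝ, volume] heatKernel t) z : ℂ) * mFourier k (-proj z) := by
      intro z
      simp only [hK, Complex.ofReal_sub, sub_mul]
    simp_rw [hsub]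
    rw [integral_sub (integrable_ofReal_mul_mFourier_neg_proj hGi k)
      (integrable_ofReal_mul_mFourier_neg_proj hCi k), integral_ofReal_mul_mFourier_neg_proj
      (Ψ ⋆[ContinuousLinearMap.lsmul ℝ ℝ, volume] heatKernel t) k, hΨF t ht _ hk', sub_zero]
  have hfun : (fun x => ∫ z : EuclideanSpace ℝ d, heatKernel t z • u (x - proj z)) =
      fun x => ∫ z : EuclideanSpace ℝ d, K z • u (x - proj z) := funext hswap
  rw [hfun]
  calc eLpNorm (fun x => ∫ z : EuclideanSpace ℝ d, K z • u (x - proj z)) p volume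
      ≤ (∫⁻ z, ‖K z‖ₑ) * eLpNorm u p volume :=
        eLpNorm_integral_kernel_smul_le hKi.aestronglyMeasurable hu.continuous hp hp'
    _ ≤ ENNReal.ofReal (C / (κ ^ 2 * t)) * eLpNorm u p volume := by
        gcongr
        exact hΨL t ht

/-! ## Subordination: `(-Δ)^{-1/2} u = π^{-1/2} ∫₀^∞ t^{-1/2} e^{tΔ} u dt` -/

omit [DecidableEq d] in
/-- Algebra of the modes: `a • Re(b • (e • c)) = Re((a b) • (e • c))` for real `a, b`. [folklore] -/
theorem smul_realPart_smul (a b : ℝ) (e : ℂ) (c : EuclideanSpace ℂ d) :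
    a • EuclideanSpace.realPart (b • (e • c)) = EuclideanSpace.realPart ((a * b) • (e • c)) := by
  rw [← map_smul, smul_smul]

/-- **Subordination formula for `|∇|⁻¹ = (-Δ)^{-1/2}` on the torus.** For a smooth real vector
field `u` on `T^d` whose non-zero Fourier modes have `|k| ≥ 1` (e.g. zero mean) and every `x`,
`((-Δ)^{-1/2} u)(x) = ∫₀^∞ π^{-1/2} t^{-1/2} (∫ G_t(z) u(x - proj z) dz) dt`:
termwise integration of the heat series `∑ₖ Re(e^{-4π²|k|²t} e_k(x) û(k))`
(`Torus.hasSum_heatSmoothing`) against `π^{-1/2} t^{-1/2} dt`, with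
`π^{-1/2}∫₀^∞ t^{-1/2} e^{-4π²|k|²t} dt = (4π²|k|²)^{-1/2}` (Stein 1970, Ch. V §3.2: Riesz
potentials by subordination to the Gauss–Weierstrass semigroup). [folklore] -/
theorem fracLaplacian_neg_half_eq_integral_heatSmoothing {u : UnitAddTorus d → EuclideanSpace ℝ d}
    (hu : IsSmooth u)
    (h1 : ∀ k, mFourierCoeff (EuclideanSpace.complexify ∘ u) k ≠ 0 → 1 ≤ freqNormSq k)
    (x : UnitAddTorus d) :
    fracLaplacian (-(1 / 2)) u x = ∫ t in Ioi (0 : ℝ), (Real.pi ^ (-(1 / 2 : ℝ)) * t ^ (-(1 / 2 : ℝ))) •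
      ∫ z : EuclideanSpace ℝ d, heatKernel t z • u (x - proj z) := by
  set c : (d → ℤ) → EuclideanSpace ℂ d := mFourierCoeff (EuclideanSpace.complexify ∘ u) with hc
  have hsum : Summable fun k => ‖c k‖ := summable_norm_mFourierCoeff_of_isSmooth hu
  set lam : (d → ℤ) → ℝ := fun k => 4 * Real.pi ^ 2 * freqNormSq k with hlam
  have hlam0 : ∀ k, 0 ≤ lam k := fun k => by have := freqNormSq_nonneg k; positivity
  have hlam1 : ∀ k, c k ≠ 0 → 1 ≤ lam k := by
    intro k hk
    have h4 : (1 : ℝ) ≤ 4 * Real.pi ^ 2 := by nlinarith [Real.two_le_pi]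
    calc (1 : ℝ) = 1 * 1 := (one_mul 1).symm
      _ ≤ 4 * Real.pi ^ 2 * freqNormSq k := mul_le_mul h4 (h1 k hk) zero_le_one (by positivity)
  set w : ℝ → ℝ := fun t => Real.pi ^ (-(1 / 2 : ℝ)) * t ^ (-(1 / 2 : ℝ)) with hw
  have hw0 : ∀ t, 0 < t → 0 ≤ w t := fun t ht => by positivity
  -- the termwise integrands in `t`
  set f : (d → ℤ) → ℝ → EuclideanSpace ℝ d := fun k t =>
    EuclideanSpace.realPart ((w t * Real.exp (-(t * lam k))) • (mFourier k x • c k)) with hf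
  -- (1) the weighted heat smoothing is the series `∑ f k t` for `t > 0`
  have hinner : ∀ t, 0 < t → w t • ∫ z : EuclideanSpace ℝ d, heatKernel t z • u (x - proj z) =
      ∑' k, f k t := by
    intro t ht
    rw [← ((hasSum_heatSmoothing hu ht x).const_smul (w t)).tsum_eq]
    refine tsum_congr fun k => ?_
    rw [hf]
    exact smul_realPart_smul _ _ _ _
  -- (2) measurability and bounds
  have hmeas : ∀ k, AEStronglyMeasurable (f k) (volume.restrict (Ioi 0)) := by
    intro k
    refine ContinuousOn.aestronglyMeasurable ?_ measurableSet_Ioi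
    refine EuclideanSpace.realPart.continuous.comp_continuousOn
      ((continuousOn_subordinationWeight.mul (Continuous.continuousOn ?_)).smul continuousOn_const)
    exact Real.continuous_exp.comp ((continuous_id.mul continuous_const).neg)
  have hnorm : ∀ k, ∀ t, 0 < t → ‖f k t‖ ≤ w t * Real.exp (-(t * lam k)) * ‖c k‖ := by
    intro k t ht
    rw [hf]
    dsimp only
    rw [map_smul, norm_smul, Real.norm_of_nonneg (mul_nonneg (hw0 t ht) (Real.exp_nonneg _))]
    exact mul_le_mul_of_nonneg_left (norm_realPart_mFourier_smul_le k x _)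
      (mul_nonneg (hw0 t ht) (Real.exp_nonneg _))
  -- the scalar integral `∫₀^∞ w(t) e^{-tλ} dt = λ^{-1/2}`
  have hscalar : ∀ k, c k ≠ 0 →
      ∫ t in Ioi (0 : ℝ), w t * Real.exp (-(t * lam k)) = (lam k) ^ (-(1 / 2 : ℝ)) := by
    intro k hk
    have hl : 0 < lam k := one_pos.trans_le (hlam1 k hk)
    simp only [hw, mul_assoc]
    rw [integral_const_mul, integral_rpow_neg_half_mul_exp_neg hl, ← mul_assoc,
      pi_rpow_neg_half_mul_sqrt_pi, one_mul]
  have hscalar_int : ∀ k, c k ≠ 0 →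
      IntegrableOn (fun t => w t * Real.exp (-(t * lam k))) (Ioi 0) := by
    intro k hk
    have hl : 0 < lam k := one_pos.trans_le (hlam1 k hk)
    simp only [hw, mul_assoc]
    exact (integrableOn_rpow_neg_half_mul_exp_neg hl).const_mul _
  have hlint : ∀ k, ∫⁻ t in Ioi 0, ‖f k t‖ₑ ≤ ENNReal.ofReal ‖c k‖ := by
    intro k
    by_cases hk : c k = 0
    · have : ∀ t, f k t = 0 := fun t => by simp [hf, hk]
      simp [this]
    calc ∫⁻ t in Ioi 0, ‖f k t‖ₑ
        ≤ ∫⁻ t in Ioi 0, ENNReal.ofReal (w t * Real.exp (-(t * lam k)) * ‖c k‖) := by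
          refine setLIntegral_mono' measurableSet_Ioi fun t ht => ?_
          rw [← ofReal_norm]
          exact ENNReal.ofReal_le_ofReal (hnorm k t ht)
      _ = ENNReal.ofReal (∫ t in Ioi 0, w t * Real.exp (-(t * lam k)) * ‖c k‖) := by
          rw [ofReal_integral_eq_lintegral_ofReal ((hscalar_int k hk).mul_const _)]
          refine (ae_restrict_iff' measurableSet_Ioi).2 (Eventually.of_forall fun t ht => ?_)
          exact mul_nonneg (mul_nonneg (hw0 t ht) (Real.exp_nonneg _)) (norm_nonneg _)
      _ = ENNReal.ofReal ((lam k) ^ (-(1 / 2 : ℝ)) * ‖c k‖) := by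
          rw [integral_mul_const, hscalar k hk]
      _ ≤ ENNReal.ofReal ‖c k‖ := by
          refine ENNReal.ofReal_le_ofReal ?_
          have : (lam k) ^ (-(1 / 2 : ℝ)) ≤ 1 :=
            Real.rpow_le_one_of_one_le_of_nonpos (hlam1 k hk) (by norm_num)
          nlinarith [norm_nonneg (c k), Real.rpow_nonneg (hlam0 k) (-(1 / 2 : ℝ))]
  have htsum : ∑' k, ∫⁻ t in Ioi 0, ‖f k t‖ₑ ≠ ⊤ := by
    refine ne_top_of_le_ne_top (ENNReal.ofReal_ne_top (r := ∑' k, ‖c k‖)) ?_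
    rw [ENNReal.ofReal_tsum_of_nonneg (fun k => norm_nonneg _) hsum]
    exact ENNReal.tsum_le_tsum hlint
  -- (3) termwise integrals
  have hterm : ∀ k, ∫ t in Ioi 0, f k t =
      EuclideanSpace.realPart (fracSymbol (-(1 / 2)) k • (mFourier k x • c k)) := by
    intro k
    by_cases hk : c k = 0
    · have : ∀ t, f k t = 0 := fun t => by simp [hf, hk]
      simp [this, hk]
    rw [hf]
    dsimp only
    rw [ContinuousLinearMap.integral_comp_comm _ ((hscalar_int k hk).smul_const _),
      integral_smul_const, hscalar k hk]
    rfl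
  -- (4) the defining series of `(-Δ)^{-1/2} u`
  have hsumm : Summable fun k : d → ℤ => fracSymbol (-(1 / 2)) k • (mFourier k x • c k) := by
    refine Summable.of_norm_bounded hsum fun k => ?_
    rw [norm_smul, Real.norm_of_nonneg (fracSymbol_nonneg _ _)]
    by_cases hk : c k = 0
    · simp [hk]
    calc fracSymbol (-(1 / 2)) k * ‖mFourier k x • c k‖ ≤ 1 * ‖c k‖ := by
          refine mul_le_mul ?_ ?_ (norm_nonneg _) zero_le_one
          · exact Real.rpow_le_one_of_one_le_of_nonpos (hlam1 k hk) (by norm_num)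
          · rw [norm_smul]
            calc ‖mFourier k x‖ * ‖c k‖ ≤ 1 * ‖c k‖ :=
                  mul_le_mul_of_nonneg_right (((mFourier k).norm_coe_le_norm x).trans_eq mFourier_norm)
                    (norm_nonneg _)
              _ = ‖c k‖ := one_mul _
      _ = ‖c k‖ := one_mul _
  -- (5) assemble
  have hinner' : EqOn (fun t : ℝ => (Real.pi ^ (-(1 / 2 : ℝ)) * t ^ (-(1 / 2 : ℝ))) •
      ∫ z : EuclideanSpace ℝ d, heatKernel t z • u (x - proj z)) (fun t => ∑' k, f k t) (Ioi 0) :=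
    fun t ht => hinner t ht
  rw [setIntegral_congr_fun measurableSet_Ioi hinner', integral_tsum hmeas htsum]
  simp_rw [hterm]
  rw [fracLaplacian_def, ContinuousLinearMap.map_tsum _ hsumm]

/-! ## The time integral `π^{-1/2} ∫₀^∞ t^{-1/2} min(1, C/(κ²t)) dt ≤ π^{-1/2} (2 + 2C) κ⁻¹` -/

omit [Fintype d] [DecidableEq d] in
/-- `∫₀^{κ⁻²} t^{-1/2} dt = 2κ⁻¹` (`lintegral` form). [folklore] -/
theorem lintegral_Ioc_rpow_neg_half {κ : ℝ} (hκ : 0 < κ) :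
    ∫⁻ t in Ioc (0 : ℝ) (κ⁻¹ ^ 2), ENNReal.ofReal (t ^ (-(1 / 2 : ℝ))) = ENNReal.ofReal (2 * κ⁻¹) := by
  have hT : (0 : ℝ) ≤ κ⁻¹ ^ 2 := by positivity
  have hint : IntervalIntegrable (fun t : ℝ => t ^ (-(1 / 2 : ℝ))) volume 0 (κ⁻¹ ^ 2) :=
    intervalIntegral.intervalIntegrable_rpow' (by norm_num)
  rw [← ofReal_integral_eq_lintegral_ofReal ((intervalIntegrable_iff_integrableOn_Ioc_of_le hT).1 hint)]
  · rw [← intervalIntegral.integral_of_le hT, integral_rpow (Or.inl (by norm_num))]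
    congr 1
    have e1 : (-(1 / 2 : ℝ)) + 1 = 1 / 2 := by norm_num
    rw [e1, Real.zero_rpow (by norm_num), sub_zero, ← Real.sqrt_eq_rpow, Real.sqrt_sq (by positivity)]
    ring
  · refine (ae_restrict_iff' measurableSet_Ioc).2 (Eventually.of_forall fun t ht => ?_)
    exact Real.rpow_nonneg ht.1.le _

omit [Fintype d] [DecidableEq d] in
/-- `∫_{κ⁻²}^∞ t^{-3/2} dt = 2κ` (`lintegral` form). [folklore] -/
theorem lintegral_Ioi_rpow_neg_three_halves {κ : ℝ} (hκ : 0 < κ) :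
    ∫⁻ t in Ioi (κ⁻¹ ^ 2 : ℝ), ENNReal.ofReal (t ^ (-(3 / 2 : ℝ))) = ENNReal.ofReal (2 * κ) := by
  rw [lintegral_Ioi_rpow (by norm_num) (by positivity)]
  congr 1
  have e1 : (-(3 / 2 : ℝ)) + 1 = -(1 / 2) := by norm_num
  rw [e1, Real.rpow_neg (by positivity), ← Real.sqrt_eq_rpow, Real.sqrt_sq (by positivity), inv_inv]
  ring

omit [Fintype d] [DecidableEq d] in
/-- **The subordination integral against the two-regime bound**: for `κ ≥ 1` and `C ≥ 0`,
`∫₀^∞ π^{-1/2} t^{-1/2} min(1, C/(κ²t)) dt ≤ π^{-1/2} (2 + 2C) κ⁻¹`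
(split at `t = κ⁻²`: `∫₀^{κ⁻²} t^{-1/2} = 2κ⁻¹`, `C κ⁻² ∫_{κ⁻²}^∞ t^{-3/2} = 2Cκ⁻¹`). [folklore] -/
theorem lintegral_subordinationWeight_mul_min_le {κ : ℝ} (hκ : 1 ≤ κ) {C : ℝ} (hC : 0 ≤ C) :
    ∫⁻ t in Ioi (0 : ℝ), ENNReal.ofReal (Real.pi ^ (-(1 / 2 : ℝ)) * t ^ (-(1 / 2 : ℝ))) *
        min 1 (ENNReal.ofReal (C / (κ ^ 2 * t))) ≤
      ENNReal.ofReal (Real.pi ^ (-(1 / 2 : ℝ)) * (2 + 2 * C) * κ⁻¹) := by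
  have hκ0 : 0 < κ := one_pos.trans_le hκ
  set T : ℝ := κ⁻¹ ^ 2 with hT
  have hT0 : 0 < T := by positivity
  set a : ℝ := Real.pi ^ (-(1 / 2 : ℝ)) with ha
  have ha0 : 0 ≤ a := by positivity
  set g : ℝ → ℝ≥0∞ := fun t => ENNReal.ofReal (a * t ^ (-(1 / 2 : ℝ))) *
    min 1 (ENNReal.ofReal (C / (κ ^ 2 * t))) with hg
  -- split the half-line at `T`
  have hsplit : ∫⁻ t in Ioi (0 : ℝ), g t = (∫⁻ t in Ioc (0 : ℝ) T, g t) + ∫⁻ t in Ioi T, g t := by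
    rw [← Ioc_union_Ioi_eq_Ioi hT0.le, lintegral_union measurableSet_Ioi
      (Set.disjoint_left.2 fun t ht ht' => (not_lt.2 ht.2) ht')]
  -- near zero: `g ≤ a t^{-1/2}`
  have h1 : ∫⁻ t in Ioc (0 : ℝ) T, g t ≤ ENNReal.ofReal (a * (2 * κ⁻¹)) := by
    calc ∫⁻ t in Ioc (0 : ℝ) T, g t ≤ ∫⁻ t in Ioc (0 : ℝ) T, ENNReal.ofReal a * ENNReal.ofReal (t ^ (-(1 / 2 : ℝ))) := by
          refine setLIntegral_mono' measurableSet_Ioc fun t ht => ?_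
          rw [hg]
          dsimp only
          rw [ENNReal.ofReal_mul ha0]
          exact (mul_le_mul' le_rfl (min_le_left _ _)).trans_eq (mul_one _)
      _ = ENNReal.ofReal a * ENNReal.ofReal (2 * κ⁻¹) := by
          rw [lintegral_const_mul' _ _ ENNReal.ofReal_ne_top, lintegral_Ioc_rpow_neg_half hκ0]
      _ = ENNReal.ofReal (a * (2 * κ⁻¹)) := by rw [← ENNReal.ofReal_mul ha0]
  -- at infinity: `g ≤ a C κ⁻² t^{-3/2}`
  have h2 : ∫⁻ t in Ioi T, g t ≤ ENNReal.ofReal (a * (C * (κ ^ 2)⁻¹) * (2 * κ)) := by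
    calc ∫⁻ t in Ioi T, g t ≤ ∫⁻ t in Ioi T, ENNReal.ofReal (a * (C * (κ ^ 2)⁻¹)) *
          ENNReal.ofReal (t ^ (-(3 / 2 : ℝ))) := by
          refine setLIntegral_mono' measurableSet_Ioi fun t ht => ?_
          have ht0 : 0 < t := hT0.trans ht
          rw [hg]
          dsimp only
          calc ENNReal.ofReal (a * t ^ (-(1 / 2 : ℝ))) * min 1 (ENNReal.ofReal (C / (κ ^ 2 * t)))
              ≤ ENNReal.ofReal (a * t ^ (-(1 / 2 : ℝ))) * ENNReal.ofReal (C / (κ ^ 2 * t)) :=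
                mul_le_mul' le_rfl (min_le_right _ _)
            _ = ENNReal.ofReal (a * (C * (κ ^ 2)⁻¹)) * ENNReal.ofReal (t ^ (-(3 / 2 : ℝ))) := by
                rw [← ENNReal.ofReal_mul (by positivity), ← ENNReal.ofReal_mul (by positivity)]
                congr 1
                have e : t ^ (-(3 / 2 : ℝ)) = t ^ (-(1 / 2 : ℝ)) * t⁻¹ := by
                  rw [← Real.rpow_neg_one, ← Real.rpow_add ht0]
                  norm_num
                rw [e]
                field_simp
      _ = ENNReal.ofReal (a * (C * (κ ^ 2)⁻¹)) * ENNReal.ofReal (2 * κ) := by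
          rw [lintegral_const_mul' _ _ ENNReal.ofReal_ne_top, lintegral_Ioi_rpow_neg_three_halves hκ0]
      _ = ENNReal.ofReal (a * (C * (κ ^ 2)⁻¹) * (2 * κ)) := by rw [← ENNReal.ofReal_mul (by positivity)]
  calc ∫⁻ t in Ioi (0 : ℝ), g t = (∫⁻ t in Ioc (0 : ℝ) T, g t) + ∫⁻ t in Ioi T, g t := hsplit
    _ ≤ ENNReal.ofReal (a * (2 * κ⁻¹)) + ENNReal.ofReal (a * (C * (κ ^ 2)⁻¹) * (2 * κ)) :=
        add_le_add h1 h2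
    _ = ENNReal.ofReal (a * (2 + 2 * C) * κ⁻¹) := by
        rw [← ENNReal.ofReal_add (by positivity) (by positivity)]
        congr 1
        field_simp

/-! ## The discharge -/

/-- Joint measurability of the weighted heat smoothing `(x, t) ↦ π^{-1/2}t^{-1/2} e^{tΔ}u(x)` on
`T^d × (0, ∞)`. [folklore] -/
theorem aestronglyMeasurable_subordination_integrand {u : UnitAddTorus d → EuclideanSpace ℝ d}
    (hu : IsSmooth u) :
    AEStronglyMeasurable (uncurry fun (x : UnitAddTorus d) (t : ℝ) =>
      (Real.pi ^ (-(1 / 2 : ℝ)) * t ^ (-(1 / 2 : ℝ))) •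
        ∫ z : EuclideanSpace ℝ d, heatKernel t z • u (x - proj z))
      ((volume : Measure (UnitAddTorus d)).prod (volume.restrict (Ioi 0))) := by
  have hcont : ContinuousOn (uncurry fun (x : UnitAddTorus d) (t : ℝ) =>
      (Real.pi ^ (-(1 / 2 : ℝ)) * t ^ (-(1 / 2 : ℝ))) •
        ∫ z : EuclideanSpace ℝ d, heatKernel t z • u (x - proj z)) (univ ×ˢ Ioi 0) := by
    have hw : ContinuousOn (fun q : UnitAddTorus d × ℝ => Real.pi ^ (-(1 / 2 : ℝ)) * q.2 ^ (-(1 / 2 : ℝ)))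
        (univ ×ˢ Ioi 0) :=
      continuousOn_subordinationWeight.comp continuous_snd.continuousOn fun q hq => hq.2
    exact hw.smul (continuousOn_heatSmoothing hu)
  have hμ : (volume : Measure (UnitAddTorus d)).prod (volume.restrict (Ioi (0 : ℝ))) =
      ((volume : Measure (UnitAddTorus d)).prod volume).restrict (univ ×ˢ Ioi 0) := by
    rw [← Measure.prod_restrict, Measure.restrict_univ]
  rw [hμ]
  exact hcont.aestronglyMeasurable (MeasurableSet.univ.prod measurableSet_Ioi)

/-- **Bernstein-type bound for `|∇|⁻¹` at frequencies `≥ κ` — discharge of the named fact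
`Torus.rieszPotential_Lp_bound_of_freqSupport`** (Buckmaster–Vicol 2019, App. B, proof of
Lemma B.1: "`‖|∇|⁻¹ P_{≥κ/2}‖_{L^p→L^p} ≲ 1/κ`, which is a direct consequence of the
Littlewood–Paley decomposition"). For `1 < p < ∞` there is `C` with
`‖(-Δ)^{-1/2}u‖_{L^p(T^d)} ≤ C κ⁻¹ ‖u‖_{L^p(T^d)}` for every `κ ≥ 1` and every smooth real vector
field `u` whose Fourier coefficients vanish on `{|k| < κ}`.

Proof (every dimension `d`, in fact for all `1 ≤ p < ∞`): subordination
`(-Δ)^{-1/2}u = ∫₀^∞ π^{-1/2}t^{-1/2} e^{tΔ}u dt`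
(`fracLaplacian_neg_half_eq_integral_heatSmoothing`), Minkowski's integral inequality in `t`
(`FunctionSpaces.eLpNorm_integral_le_lintegral_eLpNorm`), the two bounds
`‖e^{tΔ}u‖_p ≤ ‖u‖_p` (`Torus.eLpNorm_heatSmoothing_le`) and `‖e^{tΔ}u‖_p ≤ C/(κ²t) ‖u‖_p` for
`spec u ⊂ {|k| ≥ κ}` (`exists_eLpNorm_heatSmoothing_le_of_freqSupport`, the smoothed
low-frequency cancellation of the Gauss–Weierstrass kernel), and
`∫₀^∞ π^{-1/2}t^{-1/2} min(1, C/(κ²t)) dt = O(κ⁻¹)` (`lintegral_subordinationWeight_mul_min_le`).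
[cite: BuckmasterVicol2019AnnMath, App. B proof of Lemma B.1] -/
theorem rieszPotential_Lp_bound_of_freqSupport_holds : rieszPotential_Lp_bound_of_freqSupport d := by
  intro p hp hp'
  obtain ⟨C, hC0, hC⟩ := exists_eLpNorm_heatSmoothing_le_of_freqSupport (d := d)
  refine ⟨Real.toNNReal (Real.pi ^ (-(1 / 2 : ℝ)) * (2 + 2 * C)), fun κ hκ u hu hsupp => ?_⟩
  have hκ0 : 0 < κ := one_pos.trans_le hκ
  have hp1 : 1 ≤ p := hp.le
  have hpT : p ≠ ⊤ := hp'.ne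
  set w : ℝ → ℝ := fun t => Real.pi ^ (-(1 / 2 : ℝ)) * t ^ (-(1 / 2 : ℝ)) with hw
  set S : UnitAddTorus d → ℝ → EuclideanSpace ℝ d := fun x t =>
    ∫ z : EuclideanSpace ℝ d, heatKernel t z • u (x - proj z) with hS
  -- non-zero modes of `u` have `|k| ≥ κ ≥ 1`
  have h1 : ∀ k, mFourierCoeff (EuclideanSpace.complexify ∘ u) k ≠ 0 → 1 ≤ freqNormSq k := by
    intro k hk
    by_contra hlt
    push Not at hlt
    exact hk (hsupp k (hlt.trans_le (by nlinarith)))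
  -- the subordination representation
  have hrepr : fracLaplacian (-(1 / 2)) u = fun x => ∫ t in Ioi (0 : ℝ), w t • S x t :=
    funext fun x => fracLaplacian_neg_half_eq_integral_heatSmoothing hu h1 x
  rw [hrepr]
  -- the per-time bound
  have hper : ∀ t, 0 < t → eLpNorm (fun x => w t • S x t) p volume ≤
      (ENNReal.ofReal (w t) * min 1 (ENNReal.ofReal (C / (κ ^ 2 * t)))) * eLpNorm u p volume := by
    intro t ht
    have hwt : 0 ≤ w t := by positivity
    have hsm : eLpNorm (fun x => w t • S x t) p volume = ENNReal.ofReal (w t) * eLpNorm (fun x => S x t) p volume := by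
      rw [← Real.enorm_eq_ofReal hwt, ← eLpNorm_const_smul (w t) (fun x => S x t)]
      rfl
    rw [hsm, mul_assoc]
    gcongr
    rcases le_total 1 (ENNReal.ofReal (C / (κ ^ 2 * t))) with hle | hle
    · rw [min_eq_left hle, one_mul]
      exact eLpNorm_heatSmoothing_le hu.continuous ht hp1 hpT
    · rw [min_eq_right hle]
      exact hC κ hκ u hu hsupp t ht p hp1 hpT
  have hgm : Measurable fun t : ℝ => ENNReal.ofReal (w t) * min 1 (ENNReal.ofReal (C / (κ ^ 2 * t))) := by
    have hwm : Measurable w := measurable_const.mul (measurable_id.pow_const _)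
    have hqm : Measurable fun t : ℝ => C / (κ ^ 2 * t) :=
      measurable_const.div (measurable_const.mul measurable_id)
    exact hwm.ennreal_ofReal.mul (measurable_const.min hqm.ennreal_ofReal)
  calc eLpNorm (fun x => ∫ t in Ioi (0 : ℝ), w t • S x t) p volume
      ≤ ∫⁻ t in Ioi (0 : ℝ), eLpNorm (fun x => w t • S x t) p volume :=
        eLpNorm_integral_le_lintegral_eLpNorm (aestronglyMeasurable_subordination_integrand hu) hp1 hpT
    _ ≤ ∫⁻ t in Ioi (0 : ℝ), (ENNReal.ofReal (w t) * min 1 (ENNReal.ofReal (C / (κ ^ 2 * t)))) *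
          eLpNorm u p volume := setLIntegral_mono' measurableSet_Ioi fun t ht => hper t ht
    _ = (∫⁻ t in Ioi (0 : ℝ), ENNReal.ofReal (w t) * min 1 (ENNReal.ofReal (C / (κ ^ 2 * t)))) *
          eLpNorm u p volume := lintegral_mul_const _ hgm
    _ ≤ ENNReal.ofReal (Real.pi ^ (-(1 / 2 : ℝ)) * (2 + 2 * C) * κ⁻¹) * eLpNorm u p volume := by
        gcongr
        exact lintegral_subordinationWeight_mul_min_le hκ hC0
    _ = (Real.toNNReal (Real.pi ^ (-(1 / 2 : ℝ)) * (2 + 2 * C)) : ℝ≥0∞) * ENNReal.ofReal κ⁻¹ *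
          eLpNorm u p volume := by
        rw [ENNReal.ofReal_mul (by positivity)]
        rfl

/-! ## Corollary: the unweighted bound `‖|∇|⁻¹P_{≠0} u‖_p ≲ ‖u‖_p` -/

/-- **`|∇|⁻¹P_{≠0}` is bounded on `L^p(T^d)`, `1 < p < ∞` — discharge of the named fact
`Torus.rieszPotential_Lp_bound`** (Buckmaster–Vicol 2019, App. B, proof of Lemma B.1: "the bound
`‖|∇|⁻¹P_{≠0}‖_{L^p→L^p} ≲ 1` which is a direct consequence of Schauder estimates /
Hardy–Littlewood–Sobolev"). Proof: `(-Δ)^{-1/2}` annihilates constants, so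
`(-Δ)^{-1/2}u = (-Δ)^{-1/2}(u - ⨍u)`, and `u - ⨍u` has Fourier support off the unit ball; apply
`rieszPotential_Lp_bound_of_freqSupport_holds` with `κ = 1` and `‖u - ⨍u‖_p ≤ 2‖u‖_p`.
[cite: BuckmasterVicol2019AnnMath, App. B proof of Lemma B.1] -/
theorem rieszPotential_Lp_bound_holds : rieszPotential_Lp_bound d := by
  intro p hp hp'
  obtain ⟨C, hC⟩ := rieszPotential_Lp_bound_of_freqSupport_holds (d := d) p hp hp'
  refine ⟨2 * C, fun u hu => ?_⟩
  have hp1 : 1 ≤ p := hp.le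
  set m : EuclideanSpace ℝ d := ∫ x, u x with hm
  set u₀ : UnitAddTorus d → EuclideanSpace ℝ d := fun x => u x - (1 : ℝ) • m with hu₀
  have hu₀s : IsSmooth u₀ := hu.sub (isSmooth_const _)
  have hui : Integrable u volume := hu.continuous.integrable_unitAddTorus
  have hmi : Integrable (fun _ : UnitAddTorus d => m) volume := integrable_const m
  -- Fourier coefficients of `u₀`
  have hcoeff : ∀ k, mFourierCoeff (EuclideanSpace.complexify ∘ u₀) k =
      mFourierCoeff (EuclideanSpace.complexify ∘ u) k -
        (if k = 0 then EuclideanSpace.complexify m else 0) := by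
    intro k
    rw [hu₀, mFourierCoeff_complexify_sub_const_smul hui hmi 1 k, Complex.ofReal_one, one_smul]
    congr 1
    change mFourierCoeff (fun _ : UnitAddTorus d => EuclideanSpace.complexify m) k = _
    rw [mFourierCoeff_eq_integral_volume, integral_smul_const, integral_mFourier]
    by_cases hk : k = 0
    · subst hk; simp
    · simp [hk, neg_eq_zero]
  have hcoeff0 : mFourierCoeff (EuclideanSpace.complexify ∘ u) 0 = EuclideanSpace.complexify m := by
    rw [mFourierCoeff_eq_integral_volume]
    simp only [neg_zero, mFourier_zero, ContinuousMap.one_apply, one_smul, Function.comp_apply]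
    exact EuclideanSpace.complexify.integral_comp_comm u
  -- `u₀` has Fourier support off the unit ball
  have hsupp : IsFreqSupportedOff 1 u₀ := by
    intro k hk
    have hk0 : k = 0 := by
      by_contra hne
      have := one_le_freqNormSq_of_ne_zero hne
      rw [one_pow] at hk
      linarith
    subst hk0
    rw [hcoeff, if_pos rfl, hcoeff0, sub_self]
  -- `(-Δ)^{-1/2} u₀ = (-Δ)^{-1/2} u`
  have hfrac : fracLaplacian (-(1 / 2)) u₀ = fracLaplacian (-(1 / 2)) u := by
    funext x
    rw [fracLaplacian_def, fracLaplacian_def]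
    congr 1
    refine tsum_congr fun k => ?_
    by_cases hk : k = 0
    · subst hk
      rw [fracSymbol_zero (by norm_num), zero_smul, zero_smul]
    · rw [hcoeff, if_neg hk, sub_zero]
  -- `‖u₀‖_p ≤ 2 ‖u‖_p`
  have hnorm : eLpNorm u₀ p volume ≤ 2 * eLpNorm u p volume := by
    have hconst : eLpNorm (fun _ : UnitAddTorus d => (1 : ℝ) • m) p volume ≤ eLpNorm u p volume := by
      rw [one_smul, eLpNorm_const m (zero_lt_one.trans_le hp1).ne' (NeZero.ne volume), measure_univ,
        ENNReal.one_rpow, mul_one]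
      calc ‖m‖ₑ ≤ ∫⁻ x, ‖u x‖ₑ := enorm_integral_le_lintegral_enorm _
        _ = eLpNorm u 1 volume := (eLpNorm_one_eq_lintegral_enorm).symm
        _ ≤ eLpNorm u p volume :=
            eLpNorm_le_eLpNorm_of_exponent_le hp1 hu.continuous.aestronglyMeasurable
    calc eLpNorm u₀ p volume ≤ eLpNorm u p volume + eLpNorm (fun _ : UnitAddTorus d => (1 : ℝ) • m) p volume :=
          eLpNorm_sub_le hu.continuous.aestronglyMeasurable aestronglyMeasurable_const hp1
      _ ≤ eLpNorm u p volume + eLpNorm u p volume := add_le_add le_rfl hconst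
      _ = 2 * eLpNorm u p volume := (two_mul _).symm
  calc eLpNorm (fracLaplacian (-(1 / 2)) u) p volume = eLpNorm (fracLaplacian (-(1 / 2)) u₀) p volume := by
        rw [hfrac]
    _ ≤ C * ENNReal.ofReal (1 : ℝ)⁻¹ * eLpNorm u₀ p volume := hC 1 le_rfl u₀ hu₀s hsupp
    _ ≤ C * ENNReal.ofReal (1 : ℝ)⁻¹ * (2 * eLpNorm u p volume) := by gcongr
    _ = ((2 * C : ℝ≥0) : ℝ≥0∞) * eLpNorm u p volume := by
        rw [inv_one, ENNReal.ofReal_one, mul_one, ENNReal.coe_mul, ENNReal.coe_ofNat]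
        ring

end Torus

end Literature.Analysis.FluidPDE
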